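import Summits.BirchSwinnertonDyer.BirchSwinnertonDyer.Theorems.ClassRecordThreeEulerHalvesAtThreeKolyvaginFamilyLineDefs
import Mathlib.FieldTheory.Galois.Infinite
import Summits.BirchSwinnertonDyer.BirchSwinnertonDyer.Theorems.Rank1ResidualJetKolyvaginClassOrder
import HarnessLib

/-!
# (P2) McCallum's Cor. 4.5 and the order of `c_M(n)` for the GENERALISED Kolyvagin datum `JET.KolyvaginFamilyData W K ι n` —
# Galois descent `E(K̄)^{Γ_{K[n]}} = E(K[n])` along `d.emb`, «`c_M(n) = 0 ⟺ p^M ∣ P_n`», «`j • c_M(n) = 0 ⟺ p^M ∣ j • P_n`»,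
# «`p^u ∥ P_n ⟹ ord c_M(n) = p^{M−u}`» and its converse, on the standing inputs `hA` (admissibility) ∕ `hP` (invariance)
# — twins (proofs VERBATIM, datum type replaced) of x11b3-koly's `KolyCert.*` (`KolyvaginRoadThreeClassCertificate` §1–§2) and
# bsd-jet's `JET.*` (`Rank1ResidualJetKolyvaginClassOrder` §1–§2) (cell `bsd-stepL`, seat `bsd-stepL-tam3-p1` g12, owner of
# 19109's line; `--supports stmt-BirchSwinnertonDyer-19109 --as helper`)

WHY (PORT MAP (P2), RULING 46 (2)). These are the datum-generic class∕point order relations every label-entry twin of the Shimura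
walk needs (hordκ′ — `…WalkOrders`; hκt′ — `…WalkTilde*`; the glue «`PDiv` ⟹ (DIV) of `primitivesDivAtThreeInert`»): they use the
datum only through `emb`, `emb_apply`, `toGeomPoints`, `pointsSubgroup`, `derivedPoint`, `kolyvaginClass`, with admissibility `hA`
and invariance `hP` as HYPOTHESES (for the labelled CM family both are outputs of corner3-p2 g5's carrier `hpointsRk_of_shimuraLabels_of_noTorsion`).
Each proof is under RULING 46 (5)'s threshold (≤ 60 lines). The `X₀(N)` statements are recovered along `toFamilyData` (all `rfl`).

HONEST FRAMING: THEOREMS ONLY (no definition, no named fact, no `sorry`); CONDITIONAL on `hA` ∕ `hP` where displayed; nothing about any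
curve; no item closes; BSD is not proved by any of this.
References: [cite: McCallumLMS1991, §4 (4)–(6), Cor. 4.5, §5 proof of Prop. 5.2 (p. 305)] [cite: GrossLMS1991, Prop. 3.6, Lemma 4.3, Prop. 4.7 (1)]
[cite: Jetchev2008, §4.1.4 (p. 818), proof of Thm. 5.2 (p. 822)] [cite: SilvermanAEC2009, VIII.§1].
presearch: not applicable (re-keying of tree theorems); `lean search 'KolyvaginFamilyData.zsmul_kolyvaginClass'` → none.
-/

set_option autoImplicit false

noncomputable section

open scoped Classical

universe u

namespace Summit.BirchSwinnertonDyer.Rank1Residual.JET.KolyvaginFamilyData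

open WeierstrassCurve Field NumberField Literature.NumberTheory.EllipticCurves
  Literature.NumberTheory.EllipticCurves.KolyvaginCocycle

-- `K : Type`: the tree's ring-class class field theory is universe `0`.
variable {K : Type} [Field K] [NumberField K] {W : WeierstrassCurve ℚ} {ι : K →+* ℂ} {n : ℕ}
  (d : KolyvaginFamilyData W K ι n)

/-! ### §1 `Gal(K̄/K[n])` fixes `E(K[n]) ⊆ E(K̄)`; Galois descent to `K[n]` -/

/-- An element of `Γ_K` fixing `d.emb (K[n]) ⊆ K̄` pointwise fixes every point of `E(K[n]) ⊆ E(K̄)` (coordinates); twin of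
`KolyCert.smul_toGeomPoints_of_forall_emb`. [cite: SilvermanAEC2009, VIII.§1] -/
theorem smul_toGeomPoints_of_forall_emb (P : (W.baseChange (ringClassField K ι n)).toAffine.Point)
    (g : absoluteGaloisGroup K)
    (hg : ∀ x : ringClassField K ι n,
      (show AlgebraicClosure K ≃ₐ[K] AlgebraicClosure K from g) (d.emb x) = d.emb x) :
    g • d.toGeomPoints P = d.toGeomPoints P := by
  rcases P with _ | ⟨x, y, hxy⟩
  · rfl
  · have hns1 : ((W.baseChange K).baseChange (AlgebraicClosure K)).toAffine.Nonsingular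
        (d.emb x) (d.emb y) :=
      (Affine.baseChange_nonsingular W d.emb.toRatAlgHom.injective x y).mpr hxy
    change Affine.Point.map (W' := W.baseChange K)
        ((show AlgebraicClosure K ≃ₐ[K] AlgebraicClosure K from g) :
          AlgebraicClosure K →ₐ[K] AlgebraicClosure K)
        (Affine.Point.some (d.emb x) (d.emb y) hns1) =
      Affine.Point.some (d.emb x) (d.emb y) hns1
    rw [Affine.Point.map_some]
    simp only [Affine.Point.some.injEq, AlgEquiv.coe_toAlgHom]
    exact ⟨hg x, hg y⟩

/-- **Galois descent `E(K̄)^{Gal(K̄/K[n])} = E(K[n])`** along `d.emb` (infinite Galois correspondence); twin of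
`KolyCert.mem_pointsSubgroup_of_forall_smul_eq`. [cite: SilvermanAEC2009, VIII.§1] [cite: GrossLMS1991, proof of Prop. 4.7 (1)] -/
theorem mem_pointsSubgroup_of_forall_smul_eq (v : geomPoints (W.baseChange K))
    (hv : ∀ g ∈ {g : absoluteGaloisGroup K | ∀ x : ringClassField K ι n,
        (show AlgebraicClosure K ≃ₐ[K] AlgebraicClosure K from g) (d.emb x) = d.emb x},
      g • v = v) :
    v ∈ d.pointsSubgroup := by
  letI : Algebra (ringClassField K ι n) (AlgebraicClosure K) := d.emb.toAlgebra
  haveI : IsScalarTower K (ringClassField K ι n) (AlgebraicClosure K) :=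
    IsScalarTower.of_algebraMap_eq fun k ↦ (d.emb_apply k).symm
  haveI : IsGalois K (AlgebraicClosure K) := {}
  set L : IntermediateField K (AlgebraicClosure K) :=
    (IsScalarTower.toAlgHom K (ringClassField K ι n) (AlgebraicClosure K)).fieldRange with hL
  have hmemL : ∀ z : AlgebraicClosure K, z ∈ L ↔ ∃ x : ringClassField K ι n, d.emb x = z := by
    intro z
    rw [hL, AlgHom.mem_fieldRange]
    rfl
  have hfixing : ∀ g : AlgebraicClosure K ≃ₐ[K] AlgebraicClosure K, g ∈ L.fixingSubgroup →
      ∀ x : ringClassField K ι n, g (d.emb x) = d.emb x := by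
    intro g hg x
    rw [IntermediateField.mem_fixingSubgroup_iff] at hg
    exact hg _ ((hmemL _).mpr ⟨x, rfl⟩)
  have hcoord : ∀ z : AlgebraicClosure K,
      (∀ g : AlgebraicClosure K ≃ₐ[K] AlgebraicClosure K, g ∈ L.fixingSubgroup → g z = z) →
      ∃ x : ringClassField K ι n, d.emb x = z := by
    intro z hz
    rw [← hmemL, ← InfiniteGalois.fixedField_fixingSubgroup L, IntermediateField.mem_fixedField_iff]
    exact fun g hg ↦ hz g hg
  rcases v with _ | ⟨vx, vy, hv0⟩
  · exact d.pointsSubgroup.zero_mem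
  · have hxy : ∀ g : AlgebraicClosure K ≃ₐ[K] AlgebraicClosure K, g ∈ L.fixingSubgroup →
        g vx = vx ∧ g vy = vy := by
      intro g hg
      have h := hv g (hfixing g hg)
      change Affine.Point.map (W' := W.baseChange K) (g : AlgebraicClosure K →ₐ[K] AlgebraicClosure K)
          (Affine.Point.some vx vy hv0) = Affine.Point.some vx vy hv0 at h
      rw [Affine.Point.map_some] at h
      simpa only [Affine.Point.some.injEq, AlgEquiv.coe_toAlgHom] using h
    obtain ⟨x, hx⟩ := hcoord vx fun g hg ↦ (hxy g hg).1
    obtain ⟨y, hy⟩ := hcoord vy fun g hg ↦ (hxy g hg).2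
    subst hx hy
    have hxy0 : (W.baseChange (ringClassField K ι n)).toAffine.Nonsingular x y :=
      (Affine.baseChange_nonsingular W d.emb.toRatAlgHom.injective x y).mp hv0
    refine ⟨Affine.Point.some x y hxy0, ?_⟩
    change Affine.Point.map (W' := W) d.emb.toRatAlgHom (Affine.Point.some x y hxy0) = _
    rw [Affine.Point.map_some]
    rfl

/-! ### §2 McCallum Cor. 4.5: vanishing of `c_M(n)` and of `j • c_M(n)` -/

/-- **McCallum 1991 Cor. 4.5 ∕ Gross Prop. 4.7 (1)** on the standing inputs: `c_M(n) = 0 ⟺ p^M ∣ P_n` (`d.PDiv p M`); twin of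
`KolyCert.kolyvaginClass_eq_zero_iff_pDiv`. [cite: McCallumLMS1991, Cor. 4.5] [cite: GrossLMS1991, Prop. 4.7 (1)] -/
theorem kolyvaginClass_eq_zero_iff_pDiv {p : ℕ} (hp : p.Prime) (M : ℕ)
    (hA : IsAdmissible (absoluteGaloisGroup K) d.pointsSubgroup ((p ^ M : ℕ) : ℤ))
    (hP : d.toGeomPoints d.derivedPoint ∈
      invPoints (absoluteGaloisGroup K) d.pointsSubgroup ((p ^ M : ℕ) : ℤ)) :
    d.kolyvaginClass hp M = 0 ↔ d.PDiv p M := by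
  rw [d.kolyvaginClass_def hp M, dif_pos ⟨hA, hP⟩,
    kolyvaginClass_eq_zero_iff hA hP
      (N := {g : absoluteGaloisGroup K | ∀ x : ringClassField K ι n,
        (show AlgebraicClosure K ≃ₐ[K] AlgebraicClosure K from g) (d.emb x) = d.emb x})
      (fun g hg ↦ d.smul_toGeomPoints_of_forall_emb _ g hg)
      (fun v hv ↦ d.mem_pointsSubgroup_of_forall_smul_eq v fun g hg ↦ hv g hg)]
  constructor
  · rintro ⟨_, ⟨Q, rfl⟩, hQ⟩
    refine ⟨Q, Affine.Point.map_injective (W' := W) d.emb.toRatAlgHom ?_⟩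
    change d.toGeomPoints (((p ^ M : ℕ) : ℤ) • Q) = d.toGeomPoints d.derivedPoint
    rw [map_zsmul]
    exact hQ
  · rintro ⟨Q, hQ⟩
    exact ⟨d.toGeomPoints Q, ⟨Q, rfl⟩, by rw [← map_zsmul, hQ]⟩

/-- **Cor. 4.5 for the multiple `j • P_n`**: `j • c_M(n) = 0 ⟺ p^M ∣ j • P_n`; twin of `JET.zsmul_kolyvaginClass_eq_zero_iff`.
[cite: McCallumLMS1991, §4 (6), Cor. 4.5] [cite: GrossLMS1991, Prop. 4.7 (1)] -/
theorem zsmul_kolyvaginClass_eq_zero_iff {p : ℕ} (hp : p.Prime)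
    (M : ℕ) (hA : IsAdmissible (absoluteGaloisGroup K) d.pointsSubgroup ((p ^ M : ℕ) : ℤ))
    (hP : d.toGeomPoints d.derivedPoint ∈
      invPoints (absoluteGaloisGroup K) d.pointsSubgroup ((p ^ M : ℕ) : ℤ)) (j : ℤ) :
    j • d.kolyvaginClass hp M = 0 ↔
      ∃ Q : (W.baseChange (ringClassField K ι n)).toAffine.Point,
        ((p ^ M : ℕ) : ℤ) • Q = j • d.derivedPoint := by
  have hdiv := (W.baseChange K).zsmul_geomPoints_surjective_of_charZero
    (n := ((p ^ M : ℕ) : ℤ)) (by exact_mod_cast pow_ne_zero M hp.ne_zero)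
  obtain ⟨Q₀, hQ₀⟩ := hdiv (d.toGeomPoints d.derivedPoint)
  simp only at hQ₀
  have hjP : j • d.toGeomPoints d.derivedPoint ∈
      invPoints (absoluteGaloisGroup K) d.pointsSubgroup ((p ^ M : ℕ) : ℤ) :=
    AddSubgroup.zsmul_mem _ hP j
  have hjQ : ((p ^ M : ℕ) : ℤ) • (j • Q₀) = j • d.toGeomPoints d.derivedPoint := by
    rw [smul_comm, hQ₀]
  rw [d.kolyvaginClass_def hp M, dif_pos ⟨hA, hP⟩, kolyvaginClass_eq_cls hA hP hQ₀,
    ← cls_zsmul hA (continuous_smul_geomPoints _) hP hQ₀ j hjP hjQ,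
    cls_eq_zero_iff hA _ hjP hjQ
      (N := {g : absoluteGaloisGroup K | ∀ x : ringClassField K ι n,
        (show AlgebraicClosure K ≃ₐ[K] AlgebraicClosure K from g) (d.emb x) = d.emb x})
      (fun g hg ↦ by
        rw [← map_zsmul]
        exact d.smul_toGeomPoints_of_forall_emb _ g hg)
      (fun v hv ↦ d.mem_pointsSubgroup_of_forall_smul_eq v fun g hg ↦ hv g hg)]
  constructor
  · rintro ⟨_, ⟨Q, rfl⟩, hQ⟩
    refine ⟨Q, Affine.Point.map_injective (W' := W) d.emb.toRatAlgHom ?_⟩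
    change d.toGeomPoints (((p ^ M : ℕ) : ℤ) • Q) = d.toGeomPoints (j • d.derivedPoint)
    rw [map_zsmul, map_zsmul]
    exact hQ
  · rintro ⟨Q, hQ⟩
    exact ⟨d.toGeomPoints Q, ⟨Q, rfl⟩, by rw [← map_zsmul, hQ, map_zsmul]⟩

/-- `p^M`-torsion-freeness of `E(K[n])` read off admissibility: `p^i • Q = 0` with `i ≤ M` forces `Q = 0`; twin of
`JET.eq_zero_of_pow_zsmul_eq_zero_of_isAdmissible`. [folklore] -/
theorem eq_zero_of_pow_zsmul_eq_zero_of_isAdmissible {p : ℕ}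
    (M : ℕ) (hA : IsAdmissible (absoluteGaloisGroup K) d.pointsSubgroup ((p ^ M : ℕ) : ℤ))
    {i : ℕ} (hi : i ≤ M) (Q : (W.baseChange (ringClassField K ι n)).toAffine.Point)
    (hQ : ((p ^ i : ℕ) : ℤ) • Q = 0) : Q = 0 := by
  have hQM : ((p ^ M : ℕ) : ℤ) • Q = 0 := by
    obtain ⟨r, hr⟩ := Nat.exists_eq_add_of_le hi
    rw [hr, add_comm, natCast_pow_add_eq_mul, mul_smul, hQ, smul_zero]
  have h0 : d.toGeomPoints Q = 0 :=
    hA.eq_zero_of_zsmul ⟨Q, rfl⟩ (by rw [← map_zsmul, hQM, map_zero])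
  exact Affine.Point.map_injective (W' := W) d.emb.toRatAlgHom (by rw [map_zero]; exact h0)

/-! ### §3 The order of `c_M(n)` from `p^u ∥ P_n`, and back -/

/-- **`p^u ∥ P_n` with `u ≤ M` ⟹ `ord c_M(n) = p^{M−u}`** on the standing inputs; twin of `JET.addOrderOf_kolyvaginClass_of_exactDepth`.
[cite: McCallumLMS1991, §5, proof of Prop. 5.2 (p. 305)] [cite: Jetchev2008, §4.1.4 (p. 818)] -/
theorem addOrderOf_kolyvaginClass_of_exactDepth {p : ℕ}
    (hp : p.Prime) {M u : ℕ} (hu : u ≤ M)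
    (hA : IsAdmissible (absoluteGaloisGroup K) d.pointsSubgroup ((p ^ M : ℕ) : ℤ))
    (hP : d.toGeomPoints d.derivedPoint ∈
      invPoints (absoluteGaloisGroup K) d.pointsSubgroup ((p ^ M : ℕ) : ℤ))
    (hdvd : d.PDiv p u) (hndvd : ¬ d.PDiv p (u + 1)) :
    addOrderOf (d.kolyvaginClass hp M) = p ^ (M - u) := by
  haveI : Fact p.Prime := ⟨hp⟩
  obtain ⟨Q, hQ⟩ := hdvd
  have hkill : (p ^ (M - u)) • d.kolyvaginClass hp M = 0 := by
    rw [← natCast_zsmul, (d.zsmul_kolyvaginClass_eq_zero_iff hp M hA hP _)]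
    refine ⟨Q, ?_⟩
    rw [← hQ, smul_smul, ← natCast_pow_add_eq_mul, Nat.sub_add_cancel hu]
  rcases Nat.eq_zero_or_pos (M - u) with h0 | hpos
  · rw [h0, pow_zero] at hkill ⊢
    rw [one_nsmul] at hkill
    rw [hkill, addOrderOf_zero]
  · obtain ⟨r, hr⟩ : ∃ r, M - u = r + 1 := ⟨M - u - 1, by omega⟩
    rw [hr] at hkill ⊢
    refine addOrderOf_eq_prime_pow (fun habs ↦ hndvd ?_) hkill
    rw [← natCast_zsmul, d.zsmul_kolyvaginClass_eq_zero_iff hp M hA hP _] at habs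
    obtain ⟨Q', hQ'⟩ := habs
    have hru : r + u + 1 = M := by omega
    have h1 : ((p ^ (r + u) : ℕ) : ℤ) • (Q - ((p ^ 1 : ℕ) : ℤ) • Q') = 0 := by
      rw [smul_sub, smul_smul, ← natCast_pow_add_eq_mul, hru, hQ', ← hQ, smul_smul,
        ← natCast_pow_add_eq_mul, sub_self]
    have h2 : Q - ((p ^ 1 : ℕ) : ℤ) • Q' = 0 :=
      d.eq_zero_of_pow_zsmul_eq_zero_of_isAdmissible M hA (by omega) _ h1
    refine ⟨Q', ?_⟩
    rw [← hQ, (sub_eq_zero.mp h2), smul_smul, ← natCast_pow_add_eq_mul]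

/-- **`p^u ∥ P_n` with `u < M` ⟹ `c_M(n) ≠ 0`**; twin of `JET.kolyvaginClass_ne_zero_of_exactDepth`.
[cite: McCallumLMS1991, §5, proof of Prop. 5.2 (p. 305)] -/
theorem kolyvaginClass_ne_zero_of_exactDepth {p : ℕ}
    (hp : p.Prime) {M u : ℕ} (hu : u < M)
    (hA : IsAdmissible (absoluteGaloisGroup K) d.pointsSubgroup ((p ^ M : ℕ) : ℤ))
    (hP : d.toGeomPoints d.derivedPoint ∈
      invPoints (absoluteGaloisGroup K) d.pointsSubgroup ((p ^ M : ℕ) : ℤ))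
    (hdvd : d.PDiv p u) (hndvd : ¬ d.PDiv p (u + 1)) :
    d.kolyvaginClass hp M ≠ 0 :=
  McCallum1991.kolyvaginClass_ne_zero_of_addOrderOf_eq hp hu
    (d.addOrderOf_kolyvaginClass_of_exactDepth hp hu.le hA hP hdvd hndvd)

/-- Converse (divisibility half): `ord c_M(n) = p^{M−u}` with `u ≤ M` ⟹ `p^u ∣ P_n`; twin of
`JET.pow_dvd_derivedPoint_of_addOrderOf_kolyvaginClass`. [cite: McCallumLMS1991, §5 (p. 305)] -/
theorem pDiv_of_addOrderOf_kolyvaginClass {p : ℕ}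
    (hp : p.Prime) {M u : ℕ} (hu : u ≤ M)
    (hA : IsAdmissible (absoluteGaloisGroup K) d.pointsSubgroup ((p ^ M : ℕ) : ℤ))
    (hP : d.toGeomPoints d.derivedPoint ∈
      invPoints (absoluteGaloisGroup K) d.pointsSubgroup ((p ^ M : ℕ) : ℤ))
    (hord : addOrderOf (d.kolyvaginClass hp M) = p ^ (M - u)) :
    d.PDiv p u := by
  have hkill : (((p ^ (M - u) : ℕ) : ℤ)) • d.kolyvaginClass hp M = 0 := by
    rw [natCast_zsmul, ← hord, addOrderOf_nsmul_eq_zero]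
  obtain ⟨Q', hQ'⟩ := (d.zsmul_kolyvaginClass_eq_zero_iff hp M hA hP _).mp hkill
  refine ⟨Q', ?_⟩
  have h1 : ((p ^ (M - u) : ℕ) : ℤ) • (((p ^ u : ℕ) : ℤ) • Q' - d.derivedPoint) = 0 := by
    rw [smul_sub, smul_smul, ← natCast_pow_add_eq_mul, Nat.sub_add_cancel hu, hQ', sub_self]
  exact sub_eq_zero.mp (d.eq_zero_of_pow_zsmul_eq_zero_of_isAdmissible M hA (Nat.sub_le M u) _ h1)

/-- **`hordκ` for family data on the standing inputs**: `p^{k−j} ∣ ord c_k(n)` with `j < k` forces `ord_p(P_n) ≤ j` (if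
`p^{j+1} ∣ P_n` then `p^{k−j−1} • c_k(n) = 0`); the datum-generic core of tam3-p1's `Koly.hordκ_of_admissibleData` (`…WalkOrders`),
whose `hA`∕`hP` there come from `ρ̄` onto and Gross Prop. 3.6 for the `X₀(N)` points — here HYPOTHESES.
[cite: Jetchev2008, §3.1 items 4–5 (p. 817)] [cite: McCallumLMS1991, Cor. 4.5, §5 (p. 305)] -/
theorem divOrd_le_of_pow_dvd_addOrderOf_kolyvaginClass {p : ℕ} (hp : p.Prime) {k j : ℕ} (hj : j < k)
    (hA : IsAdmissible (absoluteGaloisGroup K) d.pointsSubgroup ((p ^ k : ℕ) : ℤ))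
    (hP : d.toGeomPoints d.derivedPoint ∈
      invPoints (absoluteGaloisGroup K) d.pointsSubgroup ((p ^ k : ℕ) : ℤ))
    (hdvd : p ^ (k - j) ∣ addOrderOf (d.kolyvaginClass hp k)) :
    d.divOrd p ≤ (j : ℕ∞) := by
  by_contra hlt
  rw [not_le] at hlt
  have hle : ((j + 1 : ℕ) : ℕ∞) ≤ d.divOrd p := Order.add_one_le_of_lt (by exact_mod_cast hlt)
  obtain ⟨Q, hQ⟩ := d.pDiv_of_le_divOrd p (j + 1) hle
  have hzero : ((p ^ (k - j - 1) : ℕ) : ℤ) • d.kolyvaginClass hp k = 0 := by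
    rw [d.zsmul_kolyvaginClass_eq_zero_iff hp k hA hP]
    refine ⟨Q, ?_⟩
    have hkj : k - j - 1 + (j + 1) = k := by omega
    rw [← hQ, smul_smul, ← Nat.cast_mul, ← pow_add, hkj]
  have hord : addOrderOf (d.kolyvaginClass hp k) ∣ p ^ (k - j - 1) := by
    apply addOrderOf_dvd_of_nsmul_eq_zero
    rw [← natCast_zsmul]
    exact_mod_cast hzero
  have h1 : p ^ (k - j) ∣ p ^ (k - j - 1) := dvd_trans hdvd hord
  have h2 : k - j ≤ k - j - 1 := (Nat.pow_dvd_pow_iff_le_right hp.one_lt).mp h1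
  omega

end Summit.BirchSwinnertonDyer.Rank1Residual.JET.KolyvaginFamilyData

end
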